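import Summits.QuantumFields.BalabanUV.Beta.FP.PeriodisedSymCoarseWardBiMember
import Summits.QuantumFields.BalabanUV.Beta.FP.PeriodisedSymBorderWardContactTwoInstance
import Summits.QuantumFields.BalabanUV.Beta.FP.CompositeWardLettersDefect
import Summits.QuantumFields.BalabanUV.Beta.FP.TorusSymGaugeCovariance

/-!
# `BalabanUV.Beta.FP.PeriodisedSymCompositeWardLetterTwo` — road «FP», row D1, ROUTE T, (COV) ORDER 2 at the (III′) torus door: **THE COMPOSITE WARD LETTER `b2`
# OF U21's NAMED 2-JET** — the torus half of the located answer to R-FP-62 (iii) (generic half: `CompositeWardLettersDefect`; the row `d2` for the pure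
# bi-member is the OWNER d1-p3 g25's #35 `PeriodisedSymCoarseWardBiMember.torus_d2_sym_bimember`, R-FP-63 cut (B)).

WHAT (`d = 3`, fine level `j`, coarse level `j+1`, `Lc ∣ M′`, ANY multiplier presentation `pμ′ mμ′`, comb root `ρ_c = ctr 4 Lc`; `c_j = (Lc⁴·s_j)⁻¹`; every
defining equation VERBATIM U21's ∕ T3's ∕ T4's):
* §1 **`torus_b2_defect`** — with U21's bindings VERBATIM (TWO-summand `hQ₂₂`, `hW₁ hW₂ hD₁ hD₂ hDbar hDb₁ hQ₁₁ hQ₂₁ hW₁₂ hQ₁₂ hW₂₂`, namings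
  `h𝔔₀ h𝔔₁ h𝔔₂`): **`𝔔₂ * [D₂|D₁] + 2 • (𝔔₁ * W₁) + 𝔔₀ * W₂ = [Q₂₀ * Db₂′(h,h) | 0]`**, `Db₂′(a,t̄) = c_j·((Q₁₁h)·h)(a)·[t̄ = tip a]` — U21's NAMED
  composite constraint 2-jet kills the static generators only up to the defect `[Q₂₀Db₂′ | 0]` (`c0` `TorusSymGaugeCovariance.torus_sym_cov₁∕₂`, `c1`
  `torus_c1_symVhSAt_weighted`, `c2` T3 `torus_c2_sym_weighted` (pure `Db₂`), `CompositeWardLetters.compWard_c2`, T4 `torus_d2_sym_weighted`);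
* §2 **`torus_b2_pure`** — the same with `hQ₂₂′` = the FIRST summand of U21's `hQ₂₂` ONLY (the pure bi-member): **`= 0`** — p308750's hypothesis `b2` HOLDS for
  the one-summand binding (`compWard_b2` with `c0 c1`, T3's `c2`, #35's `torus_d2_sym_bimember`).
So (FINDING F-leaf02-g24-2, CLAIMS.log l.49852): the slice exchange's `b2` is available for the door iff the coarse bi-table is the pure bi-member EVERYWHERE on the
`Q`-side (`h𝔔₂`, row `d2`, the G-side slot) — branch (♭), door U23♭ `…LamW2Q2Pure`.  [folklore] matrix algebra BY NAME over landed files; no `def`, no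
`def … : Prop`, nothing cited, 0 sorry.  WHAT THIS DOES NOT SAY: which binding the dictionary ∕ the OWNER adopt for the door of record (R-FP-62∕63).

HONEST DEPENDENCY (page 1, mandatory): continuum YM on T⁴ ⇐ BetaPertH ∧ nine spine estimates (0/9 proved); BetaPertH ⇐ (D1) ∧ (D4) ∧ CAP+tail;
G-an2-4 gates asym, D1 and NE2/3/4.  HONEST FRAMING (cell contract, verbatim): «discharging `BetaPertH` makes Bałaban's UV stability UNCONDITIONAL —
a real constructive-QFT result; it is NOT the continuum limit and NOT the Clay problem.»  ABSOLUTE RULE (cell charter, verbatim): «No internally-minted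
statement may enter as a cited fact. Every hypothesis is either kernel-proved in this package or a verbatim quotation of a PUBLISHED theorem with page
reference. The manuscript(s) under audit are NOT citable for their own disputed steps — they are the thing under adjudication; programme-internal
(2001/route/tribunal) claims are never citable.»  0 estimates; 0∕4 row-D1 binders (hW, hR, D1Tel, D1Rep); NOT (T-ID), NOT (J-a) complete, NOT SDF, NOT D1,
NOT BetaPertH, NOT continuum, NOT Clay.  D1 formalisation swarm LEAF PROVER 02 (b2b-balaban-beta-d1-formalise-leaf-02 gen 24), 2026-08-23.  No existing file touched.
-/

noncomputable section

open scoped BigOperators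

namespace Summit.QuantumFields.BalabanUV.Beta.FP.PeriodisedSymCompositeWardLetterTwo

open Finset Matrix
open Literature.Probability.LatticeModels (Torus.proj)
open Literature.MathematicalPhysics.QuantumFieldTheory.Balaban1983to89
open Literature.MathematicalPhysics.QuantumFieldTheory.Balaban1983to89.Beta
open Literature.MathematicalPhysics.QuantumFieldTheory.LatticeForm (quo)
open B4TorusKernel.MultiPeriod (translate)
open B5Prop11Plancherel (fine)
open B6Lemma24Torus (pbox)
open ExpKernelCalculus (MKer)
open AffineAveraging (Site box toSite unitVec)
open AveragingContoursRooted (ctr ctrOff ctrOff_mem_box)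
open OneStepResolventKernel (Fib)
open Summit.QuantumFields.BalabanUV.Beta.BorderedHessian (stepScale stepScale_ne_zero)
open Summit.QuantumFields.BalabanUV.Beta.DshAn1 (Dsh)
open Summit.QuantumFields.BalabanUV.Beta.SymAveragingHessianCounts (symVhSAt)
open Summit.QuantumFields.BalabanUV.Beta.SymShiftedSpread (bhKStepSh)
open Summit.QuantumFields.BalabanUV.Beta.SymSecondOrderTablesAn1 (symVh₂SAn1)
open Summit.QuantumFields.BalabanUV.Beta.FP.KernelPeriodisationFib (Idx perF)
open Summit.QuantumFields.BalabanUV.Beta.FP.KernelPeriodisationFibLoc (dper)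
open Summit.QuantumFields.BalabanUV.Beta.FP.TorusGaugeCovariance (tdelta tgrad)
open Summit.QuantumFields.BalabanUV.Beta.FP.TorusGaugeCovarianceCoarse (tgradBlock coarsePt)
open Summit.QuantumFields.BalabanUV.Beta.FP.TorusCombRows (Res)
open Summit.QuantumFields.BalabanUV.Beta.FP.PeriodisedSymCoarseWardBiMember (torus_d2_sym_bimember)
open Summit.QuantumFields.BalabanUV.Beta.FP.PeriodisedSymCoarseWardContactTwo (torus_d2_sym_weighted)
open Summit.QuantumFields.BalabanUV.Beta.FP.PeriodisedSymBorderWardContactTwoInstance (torus_c2_sym_weighted)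
open Summit.QuantumFields.BalabanUV.Beta.FP.PeriodisedSymBorderWardContactInstance (torus_c1_symVhSAt_weighted)
open Summit.QuantumFields.BalabanUV.Beta.FP.TorusSymGaugeCovariance (torus_sym_cov₁ torus_sym_cov₂)
open Summit.QuantumFields.BalabanUV.Beta.FP.CompositeWardLetters (compWard_c2 compWard_b2)

variable (M' : Fin (3 + 1) → ℕ) [∀ μ, NeZero (M' μ)] {Lc : ℕ} [NeZero Lc]

/-! ## §1 U21's NAMED composite constraint 2-jet kills the static generators only up to `[Q₂₀·Db₂′ | 0]` -/

/-- [folklore] **`torus_b2_defect` — THE COMPOSITE WARD LETTER `b2` OF U21's NAMED 2-JET, WITH U21's BINDINGS VERBATIM** (level `j`, comb root `ρ_c`;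
`Lc ∣ M′`; ANY multiplier presentation): `hQ₁₀ hQ₂₀ hQ₁₁ hQ₂₁ hW₁₂ hQ₁₂ hW₂₂` and the TWO-summand `hQ₂₂`, the generators `hD₁ hD₂ hDbar hW₁ hW₂ hDb₁`, the
namings `h𝔔₀ h𝔔₁ h𝔔₂` (U21 :245–246 with `Q₁₂ := Q₁₂ h h`, `Q₂₂ := Q₂₂ h h`) ⟹
**`𝔔₂ * fromCols D₂ D₁ + 2 • (𝔔₁ * W₁) + 𝔔₀ * W₂ = fromCols (Q₂₀ * Db₂′) 0`**, `Db₂′(a,t̄) = c_j·((Q₁₁h)·h)(a)·[t̄ = tip a]`: by `compWard_c2` the letter is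
`[Q₂₂D̄ + 2•Q₂₁Db₁ + Q₂₀Db₂ | 0]` from `c0` (`torus_sym_cov₁∕₂`), `c1` (`torus_c1_symVhSAt_weighted`), `c2` (T3, pure `Db₂`), and T4 names the inside. -/
theorem torus_b2_defect (hM' : ∀ i, Lc ∣ M' i) (j : ℕ) {κI : Type*} (pμ' : κI → ↥(pbox M')) (mμ' : κI → Fin (3 + 1))
    (h : ↥(pbox (fine Lc M')) × Fin (3 + 1) → ℝ)
    {Q₁₀ : Matrix (↥(pbox M') × Fin (3 + 1)) (↥(pbox (fine Lc M')) × Fin (3 + 1)) ℝ}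
    (hQ₁₀ : Q₁₀ = (perF (fine Lc M') (bhKStepSh 3 Lc (Dsh Lc) j)).submatrix
        (fun a : ↥(pbox M') × Fin (3 + 1) => ((coarsePt M' Lc a.1, Sum.inr a.2) : Idx (fine Lc M') (Fib 3)))
        (fun b : ↥(pbox (fine Lc M')) × Fin (3 + 1) => ((b.1, Sum.inl b.2) : Idx (fine Lc M') (Fib 3))))
    {Q₂₀ : Matrix κI (↥(pbox M') × Fin (3 + 1)) ℝ}
    (hQ₂₀ : Q₂₀ = (perF M' (bhKStepSh 3 Lc (Dsh Lc) (j + 1))).submatrix (fun a : κI => ((pμ' a, Sum.inr (mμ' a)) : Idx M' (Fib 3)))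
        (fun b : ↥(pbox M') × Fin (3 + 1) => ((b.1, Sum.inl b.2) : Idx M' (Fib 3))))
    (Q₁₁ : (↥(pbox (fine Lc M')) × Fin (3 + 1) → ℝ) → Matrix (↥(pbox M') × Fin (3 + 1)) (↥(pbox (fine Lc M')) × Fin (3 + 1)) ℝ)
    (hQ₁₁ : ∀ w, Q₁₁ w = ∑ b : ↥(pbox (fine Lc M')) × Fin (3 + 1), w b •
        (perF (fine Lc M') (dper (fine Lc M') (symVhSAt (ctr (3 + 1) Lc) 3 Lc rfl b.2 (b.1 : Site (3 + 1))))).submatrix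
          (fun a : ↥(pbox M') × Fin (3 + 1) => ((coarsePt M' Lc a.1, Sum.inr a.2) : Idx (fine Lc M') (Fib 3)))
          (fun b : ↥(pbox (fine Lc M')) × Fin (3 + 1) => ((b.1, Sum.inl b.2) : Idx (fine Lc M') (Fib 3))))
    (Q₂₁ : (↥(pbox (fine Lc M')) × Fin (3 + 1) → ℝ) → Matrix κI (↥(pbox M') × Fin (3 + 1)) ℝ)
    (hQ₂₁ : ∀ w, Q₂₁ w = ∑ b : ↥(pbox (fine Lc M')) × Fin (3 + 1), w b •
        ∑ a' : ↥(pbox M') × Fin (3 + 1), ((stepScale 3 Lc (j + 1) / (stepScale 3 Lc j ^ 2 * ((box (3 + 1) Lc).card : ℝ))) * Q₁₀ a' b) •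
          (perF M' (dper M' (symVhSAt (ctr (3 + 1) Lc) 3 Lc rfl a'.2 (a'.1 : Site (3 + 1))))).submatrix (fun a : κI => ((pμ' a, Sum.inr (mμ' a)) : Idx M' (Fib 3)))
            (fun b : ↥(pbox M') × Fin (3 + 1) => ((b.1, Sum.inl b.2) : Idx M' (Fib 3))))
    {W₁₂ : Fin (3 + 1) → Site (3 + 1) → Fin (3 + 1) → Site (3 + 1) → MKer (3 + 1) (Fib 3)}
    (hW₁₂ : W₁₂ = fun κ' u' κ u x z a c => ∑' n : Site (3 + 1), symVh₂SAn1 3 Lc κ u κ' (translate (fine Lc M') u' n) x z a c)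
    (Q₁₂ : (↥(pbox (fine Lc M')) × Fin (3 + 1) → ℝ) → (↥(pbox (fine Lc M')) × Fin (3 + 1) → ℝ)
      → Matrix (↥(pbox M') × Fin (3 + 1)) (↥(pbox (fine Lc M')) × Fin (3 + 1)) ℝ)
    (hQ₁₂ : ∀ w w', Q₁₂ w w' = -(((Lc : ℝ) ^ (3 + 1) * stepScale 3 Lc j)⁻¹) • ∑ b : ↥(pbox (fine Lc M')) × Fin (3 + 1),
        ∑ b' : ↥(pbox (fine Lc M')) × Fin (3 + 1), (w b * w' b') •
          (perF (fine Lc M') (dper (fine Lc M') (W₁₂ b'.2 (b'.1 : Site (3 + 1)) b.2 (b.1 : Site (3 + 1))))).submatrix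
            (fun a : ↥(pbox M') × Fin (3 + 1) => ((coarsePt M' Lc a.1, Sum.inr a.2) : Idx (fine Lc M') (Fib 3)))
            (fun c : ↥(pbox (fine Lc M')) × Fin (3 + 1) => ((c.1, Sum.inl c.2) : Idx (fine Lc M') (Fib 3))))
    {W₂₂ : Fin (3 + 1) → Site (3 + 1) → Fin (3 + 1) → Site (3 + 1) → MKer (3 + 1) (Fib 3)}
    (hW₂₂ : W₂₂ = fun κ' u' κ u x z a c => ∑' n : Site (3 + 1), symVh₂SAn1 3 Lc κ u κ' (translate M' u' n) x z a c)
    (Q₂₂ : (↥(pbox (fine Lc M')) × Fin (3 + 1) → ℝ) → (↥(pbox (fine Lc M')) × Fin (3 + 1) → ℝ) → Matrix κI (↥(pbox M') × Fin (3 + 1)) ℝ)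
    (hQ₂₂ : ∀ w w', Q₂₂ w w' = -(((Lc : ℝ) ^ (3 + 1) * stepScale 3 Lc (j + 1))⁻¹) • (∑ a' : ↥(pbox M') × Fin (3 + 1), ∑ a'' : ↥(pbox M') × Fin (3 + 1),
          (((stepScale 3 Lc (j + 1) / (stepScale 3 Lc j ^ 2 * ((box (3 + 1) Lc).card : ℝ))) * ∑ b : ↥(pbox (fine Lc M')) × Fin (3 + 1), Q₁₀ a' b * w b) * ((stepScale 3 Lc (j + 1) / (stepScale 3 Lc j ^ 2 * ((box (3 + 1) Lc).card : ℝ))) * ∑ b : ↥(pbox (fine Lc M')) × Fin (3 + 1), Q₁₀ a'' b * w' b)) •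
            (perF M' (dper M' (W₂₂ a''.2 (a''.1 : Site (3 + 1)) a'.2 (a'.1 : Site (3 + 1))))).submatrix (fun a : κI => ((pμ' a, Sum.inr (mμ' a)) : Idx M' (Fib 3)))
            (fun b : ↥(pbox M') × Fin (3 + 1) => ((b.1, Sum.inl b.2) : Idx M' (Fib 3))))
        + ∑ a' : ↥(pbox M') × Fin (3 + 1), ((stepScale 3 Lc (j + 1) / (stepScale 3 Lc j ^ 2 * ((box (3 + 1) Lc).card : ℝ))) * ∑ b' : ↥(pbox (fine Lc M')) × Fin (3 + 1), Q₁₁ w a' b' * w' b') •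
          (perF M' (dper M' (symVhSAt (ctr (3 + 1) Lc) 3 Lc rfl a'.2 (a'.1 : Site (3 + 1))))).submatrix (fun a : κI => ((pμ' a, Sum.inr (mμ' a)) : Idx M' (Fib 3)))
            (fun b : ↥(pbox M') × Fin (3 + 1) => ((b.1, Sum.inl b.2) : Idx M' (Fib 3))))
    {D₁ : Matrix (↥(pbox (fine Lc M')) × Fin (3 + 1)) (Res (ctr (3 + 1) Lc) Lc (fine Lc M')) ℝ}
    (hD₁ : D₁ = (tgrad (fine Lc M')).submatrix (fun b : ↥(pbox (fine Lc M')) × Fin (3 + 1) => ((b.1, Sum.inl b.2) : Idx (fine Lc M') (Fib 3)))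
        (Subtype.val : Res (ctr (3 + 1) Lc) Lc (fine Lc M') → ↥(pbox (fine Lc M'))))
    {D₂ : Matrix (↥(pbox (fine Lc M')) × Fin (3 + 1)) (Res (ctr (3 + 1) Lc) Lc M') ℝ}
    (hD₂ : D₂ = (tgradBlock M' Lc).submatrix (fun b : ↥(pbox (fine Lc M')) × Fin (3 + 1) => ((b.1, Sum.inl b.2) : Idx (fine Lc M') (Fib 3)))
        (Subtype.val : Res (ctr (3 + 1) Lc) Lc M' → ↥(pbox M')))
    {Dbar : Matrix (↥(pbox M') × Fin (3 + 1)) (Res (ctr (3 + 1) Lc) Lc M') ℝ}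
    (hDbar : Dbar = Matrix.of fun (a : ↥(pbox M') × Fin (3 + 1)) (t : Res (ctr (3 + 1) Lc) Lc M') =>
        stepScale 3 Lc j * (((box (3 + 1) Lc).card : ℝ) * tgrad M' (a.1, Sum.inl a.2) t.1))
    {W₁ : Matrix (↥(pbox (fine Lc M')) × Fin (3 + 1)) (Res (ctr (3 + 1) Lc) Lc M' ⊕ Res (ctr (3 + 1) Lc) Lc (fine Lc M')) ℝ}
    (hW₁ : W₁ = ∑ b : ↥(pbox (fine Lc M')) × Fin (3 + 1), h b •
        Matrix.of (fun (b' : ↥(pbox (fine Lc M')) × Fin (3 + 1)) (e : Res (ctr (3 + 1) Lc) Lc M' ⊕ Res (ctr (3 + 1) Lc) Lc (fine Lc M')) =>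
          if b' = b then
            -((((Lc : ℝ) ^ (3 + 1) * stepScale 3 Lc j)⁻¹)
              * Sum.elim (fun t : Res (ctr (3 + 1) Lc) Lc M' => tdelta M' (quo Lc ((b.1 : Site (3 + 1)) + unitVec b.2)) t.1)
                  (fun s : Res (ctr (3 + 1) Lc) Lc (fine Lc M') => tdelta (fine Lc M') ((b.1 : Site (3 + 1)) + unitVec b.2) s.1) e)
          else 0))
    {W₂ : Matrix (↥(pbox (fine Lc M')) × Fin (3 + 1)) (Res (ctr (3 + 1) Lc) Lc M' ⊕ Res (ctr (3 + 1) Lc) Lc (fine Lc M')) ℝ}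
    (hW₂ : W₂ = Matrix.of fun (b : ↥(pbox (fine Lc M')) × Fin (3 + 1)) (e : Res (ctr (3 + 1) Lc) Lc M' ⊕ Res (ctr (3 + 1) Lc) Lc (fine Lc M')) =>
        ((((Lc : ℝ) ^ (3 + 1) * stepScale 3 Lc j)⁻¹) * h b) ^ 2 * Sum.elim (fun t : Res (ctr (3 + 1) Lc) Lc M' => tdelta M' (quo Lc ((b.1 : Site (3 + 1)) + unitVec b.2)) t.1)
          (fun s : Res (ctr (3 + 1) Lc) Lc (fine Lc M') => tdelta (fine Lc M') ((b.1 : Site (3 + 1)) + unitVec b.2) s.1) e)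
    {Db₁ : Matrix (↥(pbox M') × Fin (3 + 1)) (Res (ctr (3 + 1) Lc) Lc M') ℝ}
    (hDb₁ : Db₁ = ∑ b : ↥(pbox (fine Lc M')) × Fin (3 + 1), h b •
        Matrix.of fun (a : ↥(pbox M') × Fin (3 + 1)) (t : Res (ctr (3 + 1) Lc) Lc M') =>
          -((((Lc : ℝ) ^ (3 + 1) * stepScale 3 Lc j)⁻¹) * Q₁₀ a b * tdelta M' ((a.1 : Site (3 + 1)) + unitVec a.2) t.1))
    {𝔔₀ 𝔔₁ 𝔔₂ : Matrix κI (↥(pbox (fine Lc M')) × Fin (3 + 1)) ℝ}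
    (h𝔔₀ : Q₂₀ * Q₁₀ = 𝔔₀) (h𝔔₁ : Q₂₁ h * Q₁₀ + Q₂₀ * Q₁₁ h = 𝔔₁)
    (h𝔔₂ : Q₂₂ h h * Q₁₀ + Q₂₁ h * Q₁₁ h + (Q₂₁ h * Q₁₁ h + Q₂₀ * Q₁₂ h h) = 𝔔₂) :
    𝔔₂ * fromCols D₂ D₁ + (2 : ℝ) • (𝔔₁ * W₁) + 𝔔₀ * W₂
      = fromCols
          (Q₂₀ * Matrix.of fun (a : ↥(pbox M') × Fin (3 + 1)) (t : Res (ctr (3 + 1) Lc) Lc M') =>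
            (((Lc : ℝ) ^ (3 + 1) * stepScale 3 Lc j)⁻¹) * (∑ b' : ↥(pbox (fine Lc M')) × Fin (3 + 1), Q₁₁ h a b' * h b') * tdelta M' ((a.1 : Site (3 + 1)) + unitVec a.2) t.1)
          (0 : Matrix κI (Res (ctr (3 + 1) Lc) Lc (fine Lc M')) ℝ) := by
  -- `c0` (order 0, `TorusSymGaugeCovariance`), `c1` ((α-1b) weighted), `c2` (T3) at these literal types
  have c0 : Q₁₀ * fromCols D₂ D₁ = fromCols Dbar 0 := by
    rw [Matrix.mul_fromCols, hQ₁₀, hD₁, hD₂, hDbar]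
    exact congrArg₂ fromCols (torus_sym_cov₂ M' j) (torus_sym_cov₁ M' j)
  have c1 : Q₁₁ h * fromCols D₂ D₁ + Q₁₀ * W₁ = fromCols Db₁ 0 := by
    rw [hQ₁₁ h, hW₁, hDb₁]
    exact torus_c1_symVhSAt_weighted M' j h hQ₁₀ hD₁ hD₂
  have c2 := torus_c2_sym_weighted M' j h hQ₁₀ Q₁₁ hQ₁₁ hW₁₂ Q₁₂ hQ₁₂ hW₁ hW₂ hD₁ hD₂
  -- T4 names the inside of `compWard_c2`'s right-hand side
  have hT4 := torus_d2_sym_weighted M' hM' j pμ' mμ' h Q₁₀ Q₁₁ hQ₂₀ Q₂₁ hQ₂₁ hW₂₂ Q₂₂ hQ₂₂ hDbar hDb₁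
    (Db₂ := Matrix.of fun (a : ↥(pbox M') × Fin (3 + 1)) (t : Res (ctr (3 + 1) Lc) Lc M') =>
        (((Lc : ℝ) ^ (3 + 1) * stepScale 3 Lc j)⁻¹) ^ 3 * (∑ b : ↥(pbox (fine Lc M')) × Fin (3 + 1), Q₁₀ a b * h b) ^ 2 * tdelta M' ((a.1 : Site (3 + 1)) + unitVec a.2) t.1) rfl
  rw [compWard_c2 Q₁₀ (Q₁₁ h) (Q₁₂ h h) Q₂₀ (Q₂₁ h) (Q₂₂ h h) (fromCols D₂ D₁) W₁ W₂ Dbar Db₁ _ c0 c1 c2 h𝔔₀ h𝔔₁ h𝔔₂]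
  -- (T3 is read at the comb root `toSite (ctrOff 4 Lc) = ctr 4 Lc` by `rfl`; `exact` sees through it)
  exact congrArg (fun X : Matrix κI (Res (ctr (3 + 1) Lc) Lc M') ℝ => fromCols X (0 : Matrix κI (Res (ctr (3 + 1) Lc) Lc (fine Lc M')) ℝ)) hT4

/-! ## §2 … and exactly for the one-summand binding -/

/-- [folklore] **`torus_b2_pure` — THE COMPOSITE WARD LETTER `b2` HOLDS FOR THE ONE-SUMMAND COARSE BI-TABLE** (same binders as `torus_b2_defect` with
`hQ₂₂′` = the FIRST summand of U21's `hQ₂₂` only): `𝔔₂ * fromCols D₂ D₁ + 2 • (𝔔₁ * W₁) + 𝔔₀ * W₂ = 0` — p308750's hypothesis `b2` for the ♭ naming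
(`compWard_b2` with `c0 c1`, T3's `c2` and #35's `torus_d2_sym_bimember`). -/
theorem torus_b2_pure (hM' : ∀ i, Lc ∣ M' i) (j : ℕ) {κI : Type*} (pμ' : κI → ↥(pbox M')) (mμ' : κI → Fin (3 + 1))
    (h : ↥(pbox (fine Lc M')) × Fin (3 + 1) → ℝ)
    {Q₁₀ : Matrix (↥(pbox M') × Fin (3 + 1)) (↥(pbox (fine Lc M')) × Fin (3 + 1)) ℝ}
    (hQ₁₀ : Q₁₀ = (perF (fine Lc M') (bhKStepSh 3 Lc (Dsh Lc) j)).submatrix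
        (fun a : ↥(pbox M') × Fin (3 + 1) => ((coarsePt M' Lc a.1, Sum.inr a.2) : Idx (fine Lc M') (Fib 3)))
        (fun b : ↥(pbox (fine Lc M')) × Fin (3 + 1) => ((b.1, Sum.inl b.2) : Idx (fine Lc M') (Fib 3))))
    {Q₂₀ : Matrix κI (↥(pbox M') × Fin (3 + 1)) ℝ}
    (hQ₂₀ : Q₂₀ = (perF M' (bhKStepSh 3 Lc (Dsh Lc) (j + 1))).submatrix (fun a : κI => ((pμ' a, Sum.inr (mμ' a)) : Idx M' (Fib 3)))
        (fun b : ↥(pbox M') × Fin (3 + 1) => ((b.1, Sum.inl b.2) : Idx M' (Fib 3))))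
    (Q₁₁ : (↥(pbox (fine Lc M')) × Fin (3 + 1) → ℝ) → Matrix (↥(pbox M') × Fin (3 + 1)) (↥(pbox (fine Lc M')) × Fin (3 + 1)) ℝ)
    (hQ₁₁ : ∀ w, Q₁₁ w = ∑ b : ↥(pbox (fine Lc M')) × Fin (3 + 1), w b •
        (perF (fine Lc M') (dper (fine Lc M') (symVhSAt (ctr (3 + 1) Lc) 3 Lc rfl b.2 (b.1 : Site (3 + 1))))).submatrix
          (fun a : ↥(pbox M') × Fin (3 + 1) => ((coarsePt M' Lc a.1, Sum.inr a.2) : Idx (fine Lc M') (Fib 3)))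
          (fun b : ↥(pbox (fine Lc M')) × Fin (3 + 1) => ((b.1, Sum.inl b.2) : Idx (fine Lc M') (Fib 3))))
    (Q₂₁ : (↥(pbox (fine Lc M')) × Fin (3 + 1) → ℝ) → Matrix κI (↥(pbox M') × Fin (3 + 1)) ℝ)
    (hQ₂₁ : ∀ w, Q₂₁ w = ∑ b : ↥(pbox (fine Lc M')) × Fin (3 + 1), w b •
        ∑ a' : ↥(pbox M') × Fin (3 + 1), ((stepScale 3 Lc (j + 1) / (stepScale 3 Lc j ^ 2 * ((box (3 + 1) Lc).card : ℝ))) * Q₁₀ a' b) •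
          (perF M' (dper M' (symVhSAt (ctr (3 + 1) Lc) 3 Lc rfl a'.2 (a'.1 : Site (3 + 1))))).submatrix (fun a : κI => ((pμ' a, Sum.inr (mμ' a)) : Idx M' (Fib 3)))
            (fun b : ↥(pbox M') × Fin (3 + 1) => ((b.1, Sum.inl b.2) : Idx M' (Fib 3))))
    {W₁₂ : Fin (3 + 1) → Site (3 + 1) → Fin (3 + 1) → Site (3 + 1) → MKer (3 + 1) (Fib 3)}
    (hW₁₂ : W₁₂ = fun κ' u' κ u x z a c => ∑' n : Site (3 + 1), symVh₂SAn1 3 Lc κ u κ' (translate (fine Lc M') u' n) x z a c)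
    (Q₁₂ : (↥(pbox (fine Lc M')) × Fin (3 + 1) → ℝ) → (↥(pbox (fine Lc M')) × Fin (3 + 1) → ℝ)
      → Matrix (↥(pbox M') × Fin (3 + 1)) (↥(pbox (fine Lc M')) × Fin (3 + 1)) ℝ)
    (hQ₁₂ : ∀ w w', Q₁₂ w w' = -(((Lc : ℝ) ^ (3 + 1) * stepScale 3 Lc j)⁻¹) • ∑ b : ↥(pbox (fine Lc M')) × Fin (3 + 1),
        ∑ b' : ↥(pbox (fine Lc M')) × Fin (3 + 1), (w b * w' b') •
          (perF (fine Lc M') (dper (fine Lc M') (W₁₂ b'.2 (b'.1 : Site (3 + 1)) b.2 (b.1 : Site (3 + 1))))).submatrix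
            (fun a : ↥(pbox M') × Fin (3 + 1) => ((coarsePt M' Lc a.1, Sum.inr a.2) : Idx (fine Lc M') (Fib 3)))
            (fun c : ↥(pbox (fine Lc M')) × Fin (3 + 1) => ((c.1, Sum.inl c.2) : Idx (fine Lc M') (Fib 3))))
    {W₂₂ : Fin (3 + 1) → Site (3 + 1) → Fin (3 + 1) → Site (3 + 1) → MKer (3 + 1) (Fib 3)}
    (hW₂₂ : W₂₂ = fun κ' u' κ u x z a c => ∑' n : Site (3 + 1), symVh₂SAn1 3 Lc κ u κ' (translate M' u' n) x z a c)
    (Q₂₂ : (↥(pbox (fine Lc M')) × Fin (3 + 1) → ℝ) → (↥(pbox (fine Lc M')) × Fin (3 + 1) → ℝ) → Matrix κI (↥(pbox M') × Fin (3 + 1)) ℝ)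
    (hQ₂₂ : ∀ w w', Q₂₂ w w' = -(((Lc : ℝ) ^ (3 + 1) * stepScale 3 Lc (j + 1))⁻¹) • (∑ a' : ↥(pbox M') × Fin (3 + 1), ∑ a'' : ↥(pbox M') × Fin (3 + 1),
          (((stepScale 3 Lc (j + 1) / (stepScale 3 Lc j ^ 2 * ((box (3 + 1) Lc).card : ℝ))) * ∑ b : ↥(pbox (fine Lc M')) × Fin (3 + 1), Q₁₀ a' b * w b) * ((stepScale 3 Lc (j + 1) / (stepScale 3 Lc j ^ 2 * ((box (3 + 1) Lc).card : ℝ))) * ∑ b : ↥(pbox (fine Lc M')) × Fin (3 + 1), Q₁₀ a'' b * w' b)) •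
            (perF M' (dper M' (W₂₂ a''.2 (a''.1 : Site (3 + 1)) a'.2 (a'.1 : Site (3 + 1))))).submatrix (fun a : κI => ((pμ' a, Sum.inr (mμ' a)) : Idx M' (Fib 3)))
            (fun b : ↥(pbox M') × Fin (3 + 1) => ((b.1, Sum.inl b.2) : Idx M' (Fib 3)))))
    {D₁ : Matrix (↥(pbox (fine Lc M')) × Fin (3 + 1)) (Res (ctr (3 + 1) Lc) Lc (fine Lc M')) ℝ}
    (hD₁ : D₁ = (tgrad (fine Lc M')).submatrix (fun b : ↥(pbox (fine Lc M')) × Fin (3 + 1) => ((b.1, Sum.inl b.2) : Idx (fine Lc M') (Fib 3)))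
        (Subtype.val : Res (ctr (3 + 1) Lc) Lc (fine Lc M') → ↥(pbox (fine Lc M'))))
    {D₂ : Matrix (↥(pbox (fine Lc M')) × Fin (3 + 1)) (Res (ctr (3 + 1) Lc) Lc M') ℝ}
    (hD₂ : D₂ = (tgradBlock M' Lc).submatrix (fun b : ↥(pbox (fine Lc M')) × Fin (3 + 1) => ((b.1, Sum.inl b.2) : Idx (fine Lc M') (Fib 3)))
        (Subtype.val : Res (ctr (3 + 1) Lc) Lc M' → ↥(pbox M')))
    {Dbar : Matrix (↥(pbox M') × Fin (3 + 1)) (Res (ctr (3 + 1) Lc) Lc M') ℝ}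
    (hDbar : Dbar = Matrix.of fun (a : ↥(pbox M') × Fin (3 + 1)) (t : Res (ctr (3 + 1) Lc) Lc M') =>
        stepScale 3 Lc j * (((box (3 + 1) Lc).card : ℝ) * tgrad M' (a.1, Sum.inl a.2) t.1))
    {W₁ : Matrix (↥(pbox (fine Lc M')) × Fin (3 + 1)) (Res (ctr (3 + 1) Lc) Lc M' ⊕ Res (ctr (3 + 1) Lc) Lc (fine Lc M')) ℝ}
    (hW₁ : W₁ = ∑ b : ↥(pbox (fine Lc M')) × Fin (3 + 1), h b •
        Matrix.of (fun (b' : ↥(pbox (fine Lc M')) × Fin (3 + 1)) (e : Res (ctr (3 + 1) Lc) Lc M' ⊕ Res (ctr (3 + 1) Lc) Lc (fine Lc M')) =>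
          if b' = b then
            -((((Lc : ℝ) ^ (3 + 1) * stepScale 3 Lc j)⁻¹)
              * Sum.elim (fun t : Res (ctr (3 + 1) Lc) Lc M' => tdelta M' (quo Lc ((b.1 : Site (3 + 1)) + unitVec b.2)) t.1)
                  (fun s : Res (ctr (3 + 1) Lc) Lc (fine Lc M') => tdelta (fine Lc M') ((b.1 : Site (3 + 1)) + unitVec b.2) s.1) e)
          else 0))
    {W₂ : Matrix (↥(pbox (fine Lc M')) × Fin (3 + 1)) (Res (ctr (3 + 1) Lc) Lc M' ⊕ Res (ctr (3 + 1) Lc) Lc (fine Lc M')) ℝ}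
    (hW₂ : W₂ = Matrix.of fun (b : ↥(pbox (fine Lc M')) × Fin (3 + 1)) (e : Res (ctr (3 + 1) Lc) Lc M' ⊕ Res (ctr (3 + 1) Lc) Lc (fine Lc M')) =>
        ((((Lc : ℝ) ^ (3 + 1) * stepScale 3 Lc j)⁻¹) * h b) ^ 2 * Sum.elim (fun t : Res (ctr (3 + 1) Lc) Lc M' => tdelta M' (quo Lc ((b.1 : Site (3 + 1)) + unitVec b.2)) t.1)
          (fun s : Res (ctr (3 + 1) Lc) Lc (fine Lc M') => tdelta (fine Lc M') ((b.1 : Site (3 + 1)) + unitVec b.2) s.1) e)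
    {Db₁ : Matrix (↥(pbox M') × Fin (3 + 1)) (Res (ctr (3 + 1) Lc) Lc M') ℝ}
    (hDb₁ : Db₁ = ∑ b : ↥(pbox (fine Lc M')) × Fin (3 + 1), h b •
        Matrix.of fun (a : ↥(pbox M') × Fin (3 + 1)) (t : Res (ctr (3 + 1) Lc) Lc M') =>
          -((((Lc : ℝ) ^ (3 + 1) * stepScale 3 Lc j)⁻¹) * Q₁₀ a b * tdelta M' ((a.1 : Site (3 + 1)) + unitVec a.2) t.1))
    {𝔔₀ 𝔔₁ 𝔔₂ : Matrix κI (↥(pbox (fine Lc M')) × Fin (3 + 1)) ℝ}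
    (h𝔔₀ : Q₂₀ * Q₁₀ = 𝔔₀) (h𝔔₁ : Q₂₁ h * Q₁₀ + Q₂₀ * Q₁₁ h = 𝔔₁)
    (h𝔔₂ : Q₂₂ h h * Q₁₀ + Q₂₁ h * Q₁₁ h + (Q₂₁ h * Q₁₁ h + Q₂₀ * Q₁₂ h h) = 𝔔₂) :
    𝔔₂ * fromCols D₂ D₁ + (2 : ℝ) • (𝔔₁ * W₁) + 𝔔₀ * W₂ = 0 := by
  have c0 : Q₁₀ * fromCols D₂ D₁ = fromCols Dbar 0 := by
    rw [Matrix.mul_fromCols, hQ₁₀, hD₁, hD₂, hDbar]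
    exact congrArg₂ fromCols (torus_sym_cov₂ M' j) (torus_sym_cov₁ M' j)
  have c1 : Q₁₁ h * fromCols D₂ D₁ + Q₁₀ * W₁ = fromCols Db₁ 0 := by
    rw [hQ₁₁ h, hW₁, hDb₁]
    exact torus_c1_symVhSAt_weighted M' j h hQ₁₀ hD₁ hD₂
  have c2 := torus_c2_sym_weighted M' j h hQ₁₀ Q₁₁ hQ₁₁ hW₁₂ Q₁₂ hQ₁₂ hW₁ hW₂ hD₁ hD₂
  have d2 := torus_d2_sym_bimember M' hM' j pμ' mμ' h Q₁₀ Q₁₁ hQ₂₀ Q₂₁ hQ₂₁ hW₂₂ Q₂₂ hQ₂₂ hDbar hDb₁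
    (Db₂ := Matrix.of fun (a : ↥(pbox M') × Fin (3 + 1)) (t : Res (ctr (3 + 1) Lc) Lc M') =>
        (((Lc : ℝ) ^ (3 + 1) * stepScale 3 Lc j)⁻¹) ^ 3 * (∑ b : ↥(pbox (fine Lc M')) × Fin (3 + 1), Q₁₀ a b * h b) ^ 2 * tdelta M' ((a.1 : Site (3 + 1)) + unitVec a.2) t.1) rfl
  exact compWard_b2 Q₁₀ (Q₁₁ h) (Q₁₂ h h) Q₂₀ (Q₂₁ h) (Q₂₂ h h) (fromCols D₂ D₁) W₁ W₂ Dbar Db₁ _ c0 c1 c2 d2 h𝔔₀ h𝔔₁ h𝔔₂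

end Summit.QuantumFields.BalabanUV.Beta.FP.PeriodisedSymCompositeWardLetterTwo

end
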